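import Summits.AnomalousDissipation.AnomalousDissipation.Theses.TaylorCertificates

/-!
# Translation invariance of quiet Euler points (crux `SmoothEulerCoerciveForce`, negative side)

Crux `TaylorCertificates.SmoothEulerCoerciveForce` (stmt-AnomalousDissipation-14097), cdisprove seat
`refuter-cdisprove-stmt-AnomalousDissipation-14097-0`.

The steady forced Euler problem on `T³` is translation invariant, so the set of NON-witnesses of the crux
(forces admitting a smooth divergence-free mean-zero quiet Euler point) is translation invariant:
`quietPoint_translate`.  Used by the planners informally ("every translate of a dodged force is excluded",
e.g. the mixed-sector Taylor–Green pattern force `F⁽⁺⁻⁾ = F_TG(· + (0,¼,0))`, card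
mixed-sector-taylor-green-coercive-candidate, is dodged by the translated Taylor–Green vortex); recorded here
as a checked lemma over the tree's pointwise torus calculus (`Torus.liftAt`, `Torus.fderiv`, `Torus.convect`,
`Torus.divergence`) and the translation invariance of `volume` (`MeasureTheory.integral_add_right_eq_self`).
No definitions; no statement of the route is asserted.
-/

noncomputable section

open MeasureTheory
open scoped InnerProductSpace

namespace Summit.AnomalousDissipation.AnomalousDissipation.Theorems.SmoothEulerCoerciveForce.Negative

open Literature.Analysis.FunctionSpaces

variable {F : Type*} [NormedAddCommGroup F] [NormedSpace ℝ F]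

omit [NormedAddCommGroup F] [NormedSpace ℝ F] in
/-- Re-centred lifts of a translate: `liftAt (f(· + a)) x = liftAt f (x + a)`. -/
theorem liftAt_comp_add_right (f : UnitAddTorus (Fin 3) → F) (a x : UnitAddTorus (Fin 3)) :
    Torus.liftAt (fun y => f (y + a)) x = Torus.liftAt f (x + a) := by
  funext v
  simp [Torus.liftAt, add_right_comm]

/-- The torus Fréchet derivative commutes with translations. -/
theorem fderiv_comp_add_right (f : UnitAddTorus (Fin 3) → F) (a x : UnitAddTorus (Fin 3)) :
    Torus.fderiv (fun y => f (y + a)) x = Torus.fderiv f (x + a) := by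
  unfold Torus.fderiv
  rw [liftAt_comp_add_right]

/-- Directional derivatives commute with translations. -/
theorem lineDeriv_comp_add_right (f : UnitAddTorus (Fin 3) → F) (a x : UnitAddTorus (Fin 3))
    (v : EuclideanSpace ℝ (Fin 3)) :
    Torus.lineDeriv (fun y => f (y + a)) x v = Torus.lineDeriv f (x + a) v := by
  unfold Torus.lineDeriv
  congr 1
  funext t
  rw [add_right_comm]

/-- Partial derivatives commute with translations. -/
theorem partialDeriv_comp_add_right (f : UnitAddTorus (Fin 3) → F) (a x : UnitAddTorus (Fin 3)) (i : Fin 3) :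
    Torus.partialDeriv i (fun y => f (y + a)) x = Torus.partialDeriv i f (x + a) :=
  lineDeriv_comp_add_right f a x _

/-- The divergence commutes with translations. -/
theorem divergence_comp_add_right (u : UnitAddTorus (Fin 3) → EuclideanSpace ℝ (Fin 3))
    (a x : UnitAddTorus (Fin 3)) :
    Torus.divergence (fun y => u (y + a)) x = Torus.divergence u (x + a) := by
  unfold Torus.divergence
  refine Finset.sum_congr rfl fun i _ => ?_
  exact partialDeriv_comp_add_right (fun y => u y i) a x i

/-- The convective derivative commutes with translations. -/
theorem convect_comp_add_right (u : UnitAddTorus (Fin 3) → EuclideanSpace ℝ (Fin 3))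
    (v : UnitAddTorus (Fin 3) → F) (a x : UnitAddTorus (Fin 3)) :
    Torus.convect (fun y => u (y + a)) (fun y => v (y + a)) x = Torus.convect u v (x + a) := by
  unfold Torus.convect
  rw [fderiv_comp_add_right]

/-- Translates of divergence-free fields are divergence free. -/
theorem isDivFree_comp_add_right {u : UnitAddTorus (Fin 3) → EuclideanSpace ℝ (Fin 3)} (hu : Torus.IsDivFree u)
    (a : UnitAddTorus (Fin 3)) : Torus.IsDivFree (fun y => u (y + a)) := fun x => by
  rw [divergence_comp_add_right, hu]

/-- Translates of mean-zero fields have zero mean (translation invariance of `volume`). -/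
theorem hasZeroMean_comp_add_right {f : UnitAddTorus (Fin 3) → F} (hf : Torus.HasZeroMean f)
    (a : UnitAddTorus (Fin 3)) : Torus.HasZeroMean (fun y => f (y + a)) := by
  unfold Torus.HasZeroMean at hf ⊢
  rw [integral_add_right_eq_self f a, hf]

/-- **Translation invariance of quiet points.** If `v` is a smooth divergence-free mean-zero quiet Euler point of
the force `f`, then `v(· + a)` is one of `f(· + a)`.  Hence the non-witness set of the crux is translation
invariant: every translate of a dodged force is dodged. -/
theorem quietPoint_translate {f v : UnitAddTorus (Fin 3) → EuclideanSpace ℝ (Fin 3)} (a : UnitAddTorus (Fin 3))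
    (hv : Torus.IsSmooth v ∧ Torus.IsDivFree v ∧ Torus.HasZeroMean v ∧
      ∀ w : UnitAddTorus (Fin 3) → EuclideanSpace ℝ (Fin 3), Torus.IsSmooth w → Torus.IsDivFree w →
        Torus.HasZeroMean w → ∫ x, ⟪Torus.convect v v x - f x, w x⟫_ℝ = 0) :
    Torus.IsSmooth (fun y => v (y + a)) ∧ Torus.IsDivFree (fun y => v (y + a)) ∧
      Torus.HasZeroMean (fun y => v (y + a)) ∧
      ∀ w : UnitAddTorus (Fin 3) → EuclideanSpace ℝ (Fin 3), Torus.IsSmooth w → Torus.IsDivFree w →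
        Torus.HasZeroMean w →
        ∫ x, ⟪Torus.convect (fun y => v (y + a)) (fun y => v (y + a)) x - f (x + a), w x⟫_ℝ = 0 := by
  obtain ⟨hs, hd, hz, hw⟩ := hv
  refine ⟨hs.comp_add_right a, isDivFree_comp_add_right hd a, hasZeroMean_comp_add_right hz a,
    fun w hws hwd hwz => ?_⟩
  -- test the original identity with the back-translated field `w(· - a)`
  have key := hw (fun y => w (y + -a)) (hws.comp_add_right (-a)) (isDivFree_comp_add_right hwd (-a))
    (hasZeroMean_comp_add_right hwz (-a))
  have hG : (fun x => ⟪Torus.convect (fun y => v (y + a)) (fun y => v (y + a)) x - f (x + a), w x⟫_ℝ) =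
      fun x => (fun x' => ⟪Torus.convect v v x' - f x', w (x' + -a)⟫_ℝ) (x + a) := by
    funext x
    simp only [convect_comp_add_right, add_neg_cancel_right]
  rw [hG, integral_add_right_eq_self (fun x' => ⟪Torus.convect v v x' - f x', w (x' + -a)⟫_ℝ) a]
  exact key

/-- **Translates of non-witnesses are non-witnesses**: if `f` admits a smooth divergence-free mean-zero quiet
Euler point, so does every translate `f(· + a)`. -/
theorem not_witness_translate {f : UnitAddTorus (Fin 3) → EuclideanSpace ℝ (Fin 3)}
    (h : ∃ v : UnitAddTorus (Fin 3) → EuclideanSpace ℝ (Fin 3), Torus.IsSmooth v ∧ Torus.IsDivFree v ∧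
      Torus.HasZeroMean v ∧
      ∀ w : UnitAddTorus (Fin 3) → EuclideanSpace ℝ (Fin 3), Torus.IsSmooth w → Torus.IsDivFree w →
        Torus.HasZeroMean w → ∫ x, ⟪Torus.convect v v x - f x, w x⟫_ℝ = 0)
    (a : UnitAddTorus (Fin 3)) :
    ∃ v : UnitAddTorus (Fin 3) → EuclideanSpace ℝ (Fin 3), Torus.IsSmooth v ∧ Torus.IsDivFree v ∧
      Torus.HasZeroMean v ∧
      ∀ w : UnitAddTorus (Fin 3) → EuclideanSpace ℝ (Fin 3), Torus.IsSmooth w → Torus.IsDivFree w →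
        Torus.HasZeroMean w → ∫ x, ⟪Torus.convect v v x - (fun y => f (y + a)) x, w x⟫_ℝ = 0 :=
  let ⟨v, hv⟩ := h
  ⟨fun y => v (y + a), quietPoint_translate a hv⟩

end Summit.AnomalousDissipation.AnomalousDissipation.Theorems.SmoothEulerCoerciveForce.Negative
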